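import Summits.Parity.BatemanHorn.Theorems.RoughValueTransportDefs
import Summits.Parity.BatemanHorn.Theorems.BalancedSemiprimeLayer.Negative.Decoration

/-!
# `BalancedSemiprimeLayer` (crux stmt-Parity-9469): a counterexample to a coordinate layer statement
# produces huge prime factors of polynomial values — why `stub_higherLayer` / `LayerHigher` has no cheap kill

Negative-side lemmas (drefute gen 3, refuter-drefute-stmt-Parity-9469-g3-0), PROVED.  The line
`smooth-modulus-twisted-hooley` leaves exactly one stub open, `stub_higherLayer`: `CoordLayerThin f i`
for coordinates of degree `d ≥ 3` (= the route's `LayerHigher`).  Here we record what a REFUTATION of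
any coordinate layer statement must exhibit: if `CoordLayerThin f i` fails (`deg fᵢ ≥ 1`), then for
EVERY `δ ∈ (0, 1/4]` there are infinitely many `x` with some `1 ≤ n ≤ x` such that `fᵢ(n) > 0` has a
prime factor `p ≥ x^{deg fᵢ(1−δ)/2}` with `p ≠ fᵢ(n)`
(`frequently_exists_large_prime_factor_of_not_coordLayerThin`): members of the layer are jointly
rough non-prime values, at most `deg fᵢ` of them are `= 1` (`card_filter_eval_eq_one_le_natDegree`),
and any other has its least prime factor above the sifting limit
(`exists_large_prime_factor_of_mem_layer`); indeed for `δ < 1/3` and `x` large every member of the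
layer has `fᵢ(n) = 1` or `fᵢ(n) = p·q` with primes `x^{deg fᵢ(1−δ)/2} ≤ p ≤ q` — the layer IS the set
of unit and balanced-semiprime values (`eventually_layer_eq_one_or_prime_mul_prime`, via the height
bound `abs_eval_natCast_le_mul_pow` and `eq_prime_mul_prime_of_rough_of_lt_cube`).  For `d ≥ 3` the exponent is `≥ 9/8`
(`nine_eighths_le_cruxExponent`), and letting `δ → 0` it is `d/2 − o(1)`: a disproof of `LayerHigher`
for a cubic would give `P(x, f) := P⁺(∏_{n ≤ x} f(n)) ≥ x^{3/2 − o(1)}` infinitely often, far beyond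
the state of the art on this Chebyshev–Erdős–Schinzel problem: for an arbitrary irreducible `f` of
degree `> 1` the record is `P(x,f) ≫ x·exp((log x)^A)`, `A = 2 − log 4 − ε` (Tenenbaum 1990); for
`X³ + 2`, `x^{1+δ}` with `δ = 10⁻³⁰³` (Heath-Brown 2001), `δ = 10⁻⁵²` (Irving, Acta Arith. 171, 2015,
arXiv:1412.0024); for every monic irreducible cubic `x^{1+c(f)}` with an inexplicit `c(f) > 0`
(Ermoshin 2026, arXiv:2602.03642, whose §1.1 is the source of this summary); for special quartics
`x^{1+δ}` with `δ = 10⁻²⁶⁵³¹` for `Φ₁₂` (Dartyge) and inexplicit exponents for even Klein-four /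
cyclic / dihedral monic quartics (La Bretèche; Dartyge–Maynard).  These cubic-field lattice methods
(prime ideal divisors of `(n − r)` of norm `x^{1+c}`) are also the only known "level beyond `x`" for a
cubic and hence the nearest technology for `LayerHigher`, which needs `p₁ ≥ x^{9/8}`.  So the residual
stub can be neither proved by Type-I methods (Ford–Maynard, `Literature.Barriers.Parity.FordMaynardLowLevel`)
nor refuted without a breakthrough in the opposite direction (from the exponent `1 + 10⁻⁵²` to `9/8`
and, as `δ → 0`, to `3/2 − o(1)` for a cubic); numerics can only illustrate it.
-/

namespace Summit.Parity.BatemanHorn.Theorems.BalancedSemiprimeLayer.Negative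

open Filter Finset Polynomial Real
open scoped Topology
open Literature.NumberTheory.Sieve
open Summit.Parity.BatemanHorn.Cruxes.BalancedSemiprimeLayer.SmoothModulusTwistedHooley
  (coordLayer CoordLayerThin)

/-- At most `deg g` naturals of any finset have `g(n) = 1` when `deg g ≥ 1`: they are roots of
`g − 1`. [folklore] -/
theorem card_filter_eval_eq_one_le_natDegree {g : ℤ[X]} (hg : 0 < g.natDegree) (s : Finset ℕ) :
    #(s.filter (fun n : ℕ => g.eval (n : ℤ) = 1)) ≤ g.natDegree := by
  have hdeg : 0 < g.degree := by
    rw [Polynomial.degree_eq_natDegree (by rintro rfl; simp at hg)]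
    exact_mod_cast hg
  calc #(s.filter (fun n : ℕ => g.eval (n : ℤ) = 1))
      ≤ #((g - C 1).roots.toFinset) := by
        refine Finset.card_le_card_of_injOn (fun n : ℕ => (n : ℤ)) ?_ ?_
        · intro n hn
          rw [Finset.mem_coe, Finset.mem_filter] at hn
          rw [Finset.mem_coe, Multiset.mem_toFinset, Polynomial.mem_roots_sub_C hdeg]
          exact hn.2
        · exact Nat.cast_injective.injOn
    _ ≤ Multiset.card (g - C 1).roots := Multiset.toFinset_card_le _
    _ ≤ g.natDegree := Polynomial.card_roots_sub_C' hdeg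

/-- **A member of the layer with value `≠ 1` has a prime factor above the sifting limit**: if
`1 ≤ n ≤ x` is jointly rough to the crux's depth, `fᵢ(n)` is not prime and `fᵢ(n) ≠ 1`, then some
prime `p ≥ x^{deg fᵢ(1−δ)/2}` divides `fᵢ(n) > 0`, and `p ≠ fᵢ(n)`. [folklore] -/
theorem exists_large_prime_factor_of_mem_layer {k : ℕ} (f : Fin k → ℤ[X]) (i : Fin k) (δ : ℝ)
    (x : ℕ) {n : ℕ}
    (hn : n ∈ (Icc 1 x).filter (fun n : ℕ => (∀ j, 0 < (f j).eval (n : ℤ) ∧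
      ∀ p ∈ range ⌈(x : ℝ) ^ (((f j).natDegree : ℝ) * (1 - δ) / 2)⌉₊,
        p.Prime → ¬ ((p : ℤ) ∣ (f j).eval (n : ℤ))) ∧ ¬ ((f i).eval (n : ℤ)).toNat.Prime))
    (h1 : (f i).eval (n : ℤ) ≠ 1) :
    0 < (f i).eval (n : ℤ) ∧ ∃ p : ℕ, p.Prime ∧
      (x : ℝ) ^ (((f i).natDegree : ℝ) * (1 - δ) / 2) ≤ p ∧
      ((p : ℤ) ∣ (f i).eval (n : ℤ)) ∧ (f i).eval (n : ℤ) ≠ p := by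
  rw [mem_filter] at hn
  obtain ⟨-, hrough, hnp⟩ := hn
  obtain ⟨hpos, hsift⟩ := hrough i
  set v : ℤ := (f i).eval (n : ℤ) with hv
  have hvnat : ((v.toNat : ℕ) : ℤ) = v := Int.toNat_of_nonneg hpos.le
  have hv1 : v.toNat ≠ 1 := by
    intro h
    apply h1
    rw [← hvnat, h]
    norm_num
  set p : ℕ := v.toNat.minFac with hp
  have hpp : p.Prime := Nat.minFac_prime hv1
  have hpdvdnat : p ∣ v.toNat := Nat.minFac_dvd _
  have hpdvd : (p : ℤ) ∣ v := by
    rw [← hvnat]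
    exact Int.natCast_dvd_natCast.mpr hpdvdnat
  refine ⟨hpos, p, hpp, ?_, hpdvd, ?_⟩
  · -- roughness: `p ∉ range ⌈z⌉₊`, i.e. `⌈z⌉₊ ≤ p`
    have hnot : p ∉ range ⌈(x : ℝ) ^ (((f i).natDegree : ℝ) * (1 - δ) / 2)⌉₊ :=
      fun hmem => hsift p hmem hpp hpdvd
    rw [mem_range, not_lt] at hnot
    exact Nat.ceil_le.mp hnot
  · -- `v ≠ p` since `v` is not prime
    intro hvp
    apply hnp
    have : v.toNat = p := by exact_mod_cast hvnat.trans hvp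
    rw [this]
    exact hpp

/-- **A counterexample to a coordinate layer statement produces huge prime factors**: if
`CoordLayerThin f i` fails and `deg fᵢ ≥ 1`, then for every `δ ∈ (0, 1/4]`, frequently in `x`, some
`1 ≤ n ≤ x` has `fᵢ(n) > 0` divisible by a prime `p ≥ x^{deg fᵢ(1−δ)/2}` with `p ≠ fᵢ(n)` — i.e.
`P⁺`-type events beyond the Erdős–Schinzel records for every degree `≥ 2`. [folklore] -/
theorem frequently_exists_large_prime_factor_of_not_coordLayerThin {k : ℕ} {f : Fin k → ℤ[X]}
    (i : Fin k) (hdeg : 0 < (f i).natDegree) (h : ¬ CoordLayerThin f i)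
    {δ : ℝ} (hδ0 : 0 < δ) (hδ4 : δ ≤ 1 / 4) :
    ∃ᶠ x : ℕ in atTop, ∃ n ∈ Icc 1 x, 0 < (f i).eval (n : ℤ) ∧ ∃ p : ℕ, p.Prime ∧
      (x : ℝ) ^ (((f i).natDegree : ℝ) * (1 - δ) / 2) ≤ p ∧
      ((p : ℤ) ∣ (f i).eval (n : ℤ)) ∧ (f i).eval (n : ℤ) ≠ p := by
  unfold CoordLayerThin at h
  push Not at h
  obtain ⟨ε, hε, H⟩ := h
  -- `H δ … : ∃ᶠ x, ε x/(log x)^k < E_{f,i}(x, δ)` (`push Not` has rewritten `¬ ∀ᶠ … ≤ …`)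
  have hfreq : ∃ᶠ x : ℕ in atTop, ε * (x : ℝ) / Real.log x ^ k < (coordLayer f i δ x : ℝ) :=
    H δ hδ0 hδ4
  have hev : ∀ᶠ x : ℕ in atTop, ((f i).natDegree : ℝ) + 1 ≤ ε * (x : ℝ) / Real.log x ^ k :=
    (tendsto_mul_div_log_pow_atTop hε k).eventually_ge_atTop _
  refine (hfreq.and_eventually hev).mono fun x hx => ?_
  obtain ⟨hbig, hge⟩ := hx
  -- the layer set
  set S : Finset ℕ := (Icc 1 x).filter (fun n : ℕ => (∀ j, 0 < (f j).eval (n : ℤ) ∧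
    ∀ p ∈ range ⌈(x : ℝ) ^ (((f j).natDegree : ℝ) * (1 - δ) / 2)⌉₊,
      p.Prime → ¬ ((p : ℤ) ∣ (f j).eval (n : ℤ))) ∧ ¬ ((f i).eval (n : ℤ)).toNat.Prime) with hS
  have hcard : coordLayer f i δ x = #S := rfl
  have hgt : ((f i).natDegree : ℝ) + 1 < (#S : ℝ) := by
    rw [← hcard]; linarith
  have hgt' : (f i).natDegree + 1 < #S := by exact_mod_cast hgt
  -- at most `deg fᵢ` members have value `1`; pick another one
  have hsplit := Finset.card_filter_add_card_filter_not (s := S) (fun n : ℕ => (f i).eval (n : ℤ) = 1)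
  have hone := card_filter_eval_eq_one_le_natDegree hdeg S
  have hne : (S.filter fun n : ℕ => ¬ (f i).eval (n : ℤ) = 1).Nonempty := by
    rw [← Finset.card_pos]
    omega
  obtain ⟨n, hn⟩ := hne
  rw [mem_filter] at hn
  obtain ⟨hnS, hn1⟩ := hn
  have hnI : n ∈ Icc 1 x := (mem_filter.mp hnS).1
  obtain ⟨hpos, p, hpp, hzp, hpdvd, hvp⟩ := exists_large_prime_factor_of_mem_layer f i δ x hnS hn1
  exact ⟨n, hnI, hpos, p, hpp, hzp, hpdvd, hvp⟩

/-- For a coordinate of degree `d ≥ 3` and `δ ≤ 1/4` the crux exponent is at least `9/8`: the prime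
factors produced above exceed `x^{9/8} > x` (the number of terms) — the regime where no Type-I
information exists and where nothing is known towards `P⁺(∏_{n≤x} f(n)) > x^{1+c}` beyond
`c = 10⁻⁵²` for `X³ + 2`. [folklore] -/
theorem nine_eighths_le_cruxExponent {d : ℕ} (hd : 3 ≤ d) {δ : ℝ} (hδ : δ ≤ 1 / 4) :
    (9 : ℝ) / 8 ≤ (d : ℝ) * (1 - δ) / 2 := by
  have hd' : (3 : ℝ) ≤ d := by exact_mod_cast hd
  nlinarith

/-- **Corollary for the residual stub** (`stub_higherLayer` / `LayerHigher`): if some Bateman–Horn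
coordinate of degree `≥ 3` had a fat layer, then for every `δ ∈ (0, 1/4]`, infinitely often some
`n ≤ x` would have a prime factor `p ∣ fᵢ(n)`, `p ≠ fᵢ(n)`, with `p ≥ x^{deg fᵢ(1−δ)/2} ≥ x^{9/8}`.
[folklore] -/
theorem frequently_exists_prime_factor_gt_nine_eighths_of_not_higherLayer {k : ℕ}
    {f : Fin k → ℤ[X]} (i : Fin k) (hdeg : 3 ≤ (f i).natDegree) (h : ¬ CoordLayerThin f i)
    {δ : ℝ} (hδ0 : 0 < δ) (hδ4 : δ ≤ 1 / 4) :
    ∃ᶠ x : ℕ in atTop, ∃ n ∈ Icc 1 x, ∃ p : ℕ, p.Prime ∧ (x : ℝ) ^ ((9 : ℝ) / 8) ≤ p ∧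
      ((p : ℤ) ∣ (f i).eval (n : ℤ)) ∧ 0 < (f i).eval (n : ℤ) ∧ (f i).eval (n : ℤ) ≠ p := by
  have h9 := nine_eighths_le_cruxExponent hdeg hδ4
  refine ((frequently_exists_large_prime_factor_of_not_coordLayerThin i (by omega) h hδ0
    hδ4).and_eventually (eventually_ge_atTop 1)).mono fun x hx => ?_
  obtain ⟨⟨n, hnI, hpos, p, hpp, hzp, hpdvd, hvp⟩, hx1⟩ := hx
  refine ⟨n, hnI, p, hpp, le_trans ?_ hzp, hpdvd, hpos, hvp⟩
  exact Real.rpow_le_rpow_of_exponent_le (by exact_mod_cast hx1) h9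

/-! ### What the layer counts: values `1` or balanced semiprimes `p·q` (for `δ < 1/3`) -/

/-- Height bound: for `1 ≤ n ≤ x`, `|g(n)| ≤ (∑ⱼ |gⱼ|)·x^{deg g}`. [folklore] -/
theorem abs_eval_natCast_le_mul_pow (g : ℤ[X]) {n x : ℕ} (hn1 : 1 ≤ n) (hnx : n ≤ x) :
    |g.eval (n : ℤ)| ≤ (∑ j ∈ range (g.natDegree + 1), |g.coeff j|) * (x : ℤ) ^ g.natDegree := by
  rw [eval_eq_sum_range, Finset.sum_mul]
  refine (abs_sum_le_sum_abs _ _).trans (sum_le_sum fun j hj => ?_)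
  have hj : j ≤ g.natDegree := Nat.lt_succ_iff.mp (mem_range.mp hj)
  have hx1 : (1 : ℤ) ≤ x := by exact_mod_cast hn1.trans hnx
  have h1 : ((n : ℤ)) ^ j ≤ (x : ℤ) ^ j := pow_le_pow_left₀ (by positivity) (by exact_mod_cast hnx) j
  have h2 : (x : ℤ) ^ j ≤ (x : ℤ) ^ g.natDegree := pow_le_pow_right₀ hx1 hj
  rw [abs_mul, abs_pow, Nat.abs_cast]
  exact mul_le_mul_of_nonneg_left (h1.trans h2) (abs_nonneg _)

/-- A natural number `v ≠ 0, 1` which is not prime, all of whose prime factors are `≥ z`, and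
which is `< z³`, is a product of exactly two primes `z ≤ p ≤ q`. [folklore] -/
theorem eq_prime_mul_prime_of_rough_of_lt_cube {v z : ℕ} (hv0 : v ≠ 0) (hv1 : v ≠ 1)
    (hvp : ¬ v.Prime) (hrough : ∀ p : ℕ, p.Prime → p ∣ v → z ≤ p) (hlt : v < z ^ 3) :
    ∃ p q : ℕ, p.Prime ∧ q.Prime ∧ z ≤ p ∧ p ≤ q ∧ v = p * q := by
  have hprod : v.primeFactorsList.prod = v := Nat.prod_primeFactorsList hv0
  have hmem : ∀ p ∈ v.primeFactorsList, z ≤ p := fun p hp =>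
    hrough p (Nat.prime_of_mem_primeFactorsList hp) (Nat.dvd_of_mem_primeFactorsList hp)
  have hpow : z ^ v.primeFactorsList.length ≤ v := by
    have := List.pow_card_le_prod v.primeFactorsList z hmem
    rwa [hprod] at this
  have hz : 1 ≤ z := by
    rcases Nat.eq_zero_or_pos z with rfl | h
    · simp at hlt
    · exact h
  have hlen : v.primeFactorsList.length ≤ 2 := by
    by_contra h
    push Not at h
    have h3 : z ^ 3 ≤ z ^ v.primeFactorsList.length := Nat.pow_le_pow_right hz h
    omega
  -- the list has length exactly 2
  rcases hL : v.primeFactorsList with _ | ⟨p, _ | ⟨q, _ | ⟨r, t⟩⟩⟩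
  · rw [hL] at hprod
    simp at hprod
    exact absurd hprod.symm hv1
  · rw [hL] at hprod
    simp at hprod
    have hp : p.Prime := Nat.prime_of_mem_primeFactorsList (n := v) (by rw [hL]; simp)
    rw [hprod] at hp
    exact absurd hp hvp
  · have hp : p.Prime := Nat.prime_of_mem_primeFactorsList (n := v) (by rw [hL]; simp)
    have hq : q.Prime := Nat.prime_of_mem_primeFactorsList (n := v) (by rw [hL]; simp)
    have hzp : z ≤ p := hmem p (by rw [hL]; simp)
    have hzq : z ≤ q := hmem q (by rw [hL]; simp)
    rw [hL] at hprod
    simp at hprod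
    rcases le_total p q with hpq | hqp
    · exact ⟨p, q, hp, hq, hzp, hpq, by rw [hprod]⟩
    · exact ⟨q, p, hq, hp, hzq, hqp, by rw [mul_comm, hprod]⟩
  · rw [hL] at hlen
    simp at hlen

/-- **The layer counts unit values and balanced semiprimes only** (`δ < 1/3`, `deg fᵢ ≥ 1`): for
all large `x`, every `n` of the layer `E_{f,i}(x, δ)` has `fᵢ(n) = 1` or `fᵢ(n) = p·q` with primes
`x^{deg fᵢ(1−δ)/2} ≤ p ≤ q` (a third prime factor would push the value above
`x^{3·deg fᵢ(1−δ)/2} > (∑|coeff|)·x^{deg fᵢ} ≥ fᵢ(n)`). [folklore] -/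
theorem eventually_layer_eq_one_or_prime_mul_prime {k : ℕ} (f : Fin k → ℤ[X]) (i : Fin k)
    (hdeg : 0 < (f i).natDegree) {δ : ℝ} (hδ3 : δ < 1 / 3) :
    ∀ᶠ x : ℕ in atTop, ∀ n ∈ (Icc 1 x).filter (fun n : ℕ => (∀ j, 0 < (f j).eval (n : ℤ) ∧
        ∀ p ∈ range ⌈(x : ℝ) ^ (((f j).natDegree : ℝ) * (1 - δ) / 2)⌉₊,
          p.Prime → ¬ ((p : ℤ) ∣ (f j).eval (n : ℤ))) ∧ ¬ ((f i).eval (n : ℤ)).toNat.Prime),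
      (f i).eval (n : ℤ) = 1 ∨ ∃ p q : ℕ, p.Prime ∧ q.Prime ∧
        (x : ℝ) ^ (((f i).natDegree : ℝ) * (1 - δ) / 2) ≤ p ∧ p ≤ q ∧
        (f i).eval (n : ℤ) = (p : ℤ) * q := by
  set d : ℕ := (f i).natDegree with hd
  set B : ℤ := ∑ j ∈ range (d + 1), |(f i).coeff j| with hB
  have hB0 : (0 : ℝ) ≤ (B : ℝ) := by
    have : (0 : ℤ) ≤ B := sum_nonneg fun j _ => abs_nonneg _
    exact_mod_cast this
  -- eventually `B·x^d < x^{3e}`, `e = d(1−δ)/2`, since `3e − d = d(1 − 3δ)/2 > 0`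
  have hexp : 0 < (d : ℝ) * (1 - 3 * δ) / 2 := by
    have : (0 : ℝ) < d := by exact_mod_cast hdeg
    have : 0 < 1 - 3 * δ := by linarith
    positivity
  have hev : ∀ᶠ x : ℕ in atTop, (B : ℝ) < (x : ℝ) ^ ((d : ℝ) * (1 - 3 * δ) / 2) :=
    ((tendsto_rpow_atTop hexp).comp tendsto_natCast_atTop_atTop).eventually_gt_atTop _
  filter_upwards [hev, eventually_ge_atTop 1] with x hx hx1 n hn
  have hx1' : (1 : ℝ) ≤ x := by exact_mod_cast hx1
  have hx0 : (0 : ℝ) < x := by linarith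
  by_cases h1 : (f i).eval (n : ℤ) = 1
  · exact Or.inl h1
  right
  have hn' := hn
  rw [mem_filter, mem_Icc] at hn'
  obtain ⟨⟨hn1, hnx⟩, hrough, hnp⟩ := hn'
  obtain ⟨hpos, hsift⟩ := hrough i
  set v : ℤ := (f i).eval (n : ℤ) with hv
  have hvnat : ((v.toNat : ℕ) : ℤ) = v := Int.toNat_of_nonneg hpos.le
  have hv0 : v.toNat ≠ 0 := by
    intro h; rw [h] at hvnat; simp at hvnat; linarith
  have hv1 : v.toNat ≠ 1 := by
    intro h; apply h1; rw [← hvnat, h]; norm_num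
  set z : ℕ := ⌈(x : ℝ) ^ ((d : ℝ) * (1 - δ) / 2)⌉₊ with hz
  have hroughN : ∀ p : ℕ, p.Prime → p ∣ v.toNat → z ≤ p := by
    intro p hp hpd
    have hpd' : (p : ℤ) ∣ v := by rw [← hvnat]; exact Int.natCast_dvd_natCast.mpr hpd
    by_contra hlt
    push Not at hlt
    exact hsift p (mem_range.mpr hlt) hp hpd'
  -- size: `v ≤ B x^d < x^{3e} ≤ z^3`
  have hvle : (v : ℝ) ≤ (B : ℝ) * (x : ℝ) ^ (d : ℝ) := by
    have h := abs_eval_natCast_le_mul_pow (f i) hn1 hnx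
    have h' : v ≤ B * (x : ℤ) ^ d := (le_abs_self v).trans h
    have h'' : (v : ℝ) ≤ (B : ℝ) * (x : ℝ) ^ d := by exact_mod_cast h'
    rwa [← Real.rpow_natCast] at h''
  have h3e : (B : ℝ) * (x : ℝ) ^ (d : ℝ) < ((x : ℝ) ^ ((d : ℝ) * (1 - δ) / 2)) ^ 3 := by
    rw [← Real.rpow_natCast, ← Real.rpow_mul hx0.le]
    have hsplit : (x : ℝ) ^ ((d : ℝ) * (1 - δ) / 2 * (3 : ℕ)) =
        (x : ℝ) ^ ((d : ℝ) * (1 - 3 * δ) / 2) * (x : ℝ) ^ (d : ℝ) := by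
      rw [← Real.rpow_add hx0]
      congr 1
      push_cast
      ring
    rw [hsplit]
    exact mul_lt_mul_of_pos_right hx (Real.rpow_pos_of_pos hx0 _)
  have hzle : ((x : ℝ) ^ ((d : ℝ) * (1 - δ) / 2)) ^ 3 ≤ ((z : ℕ) : ℝ) ^ 3 := by
    gcongr
    exact Nat.le_ceil _
  have hvlt : (v.toNat : ℝ) < ((z : ℕ) : ℝ) ^ 3 := by
    have : ((v.toNat : ℕ) : ℝ) = (v : ℝ) := by exact_mod_cast hvnat
    rw [this]
    linarith
  have hvltN : v.toNat < z ^ 3 := by exact_mod_cast hvlt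
  obtain ⟨p, q, hp, hq, hzp, hpq, hvpq⟩ :=
    eq_prime_mul_prime_of_rough_of_lt_cube hv0 hv1 hnp hroughN hvltN
  refine ⟨p, q, hp, hq, ?_, hpq, ?_⟩
  · exact (Nat.le_ceil _).trans (by exact_mod_cast hzp)
  · rw [← hvnat, hvpq]
    push_cast
    ring

end Summit.Parity.BatemanHorn.Theorems.BalancedSemiprimeLayer.Negative
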